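import Literature.AlgebraicGeometry.Resolution.FibreComponentsBaseChange
import Literature.Topology.KrullDimensionDrop
import Literature.AlgebraicGeometry.Motives.SubschemeCyclesPushPullProofs
import Literature.AlgebraicGeometry.Motives.AbelianVarietyTorsionProofs
import Literature.AlgebraicGeometry.Motives.AbelianVarietyAmpleProofs
import Literature.NumberTheory.DiophantineGeometry.AVIsogenyFlat
import HarnessLib

/-!
# The dimension formula `dim A = dim B + dim Ker f`; surjective homomorphisms of the same
# dimension are isogenies

For a surjective homomorphism `f : A → B` of abelian varieties over a field `K` with kernel
`Ker f = A ×_{B, e} Spec K` (`AbelianVariety.Hom.ker`, `Hom.kerToSpec`, `AVIsogenyFlat`):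

* `topologicalKrullDim_eq_of_isPullback` — **the dimension of a scheme locally of finite type over
  a field is invariant under extension of the base field** (Görtz–Wedhorn I, Prop. 5.38), from the
  pointwise statement `height_eq_height_apply_of_isMax` of `Resolution/FibreComponentsBaseChange`
  (maximal points of `X ×ₖ Spec L` have the height of their images) and the surjectivity of
  `X ×ₖ Spec L → X`;
* `AbelianVariety.topologicalKrullDim_fiber_eq_ker` — the generic fibre `A_{f ξ}` and the kernel
  have the same dimension: after base change to `κ(ξ)` they become isomorphic by the translation
  isomorphism `A ×_B Spec κ(ξ) ≅ Spec κ(ξ) ×_K Ker f` (`transIso`, Görtz–Wedhorn II, (27.9.1));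
* `AbelianVariety.dim_eq_dim_add_topologicalKrullDim_ker` — **`dim A = dim B + dim Ker f`**
  (Görtz–Wedhorn II, Prop. 27.176 / Cor. 27.63: the fibres are torsors under the kernel; Milne
  1986, §8): `dim A = height ξ = height (f ξ) + height_{A_{f ξ}} ξ` by additivity of transcendence
  degrees (`Scheme.height_eq_height_add_height_asFiber`, Stacks 02JW), `f ξ` is the generic point of
  `B`, and every point `z` of the generic fibre has `dim B + height z ≤ dim A`;
* `finite_of_topologicalKrullDim_le_zero` — a noetherian scheme of dimension `≤ 0` is finite;
  `AbelianVariety.isFinite_kerToSpec_of_topologicalKrullDim_le_zero` — a zero-dimensional kernel is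
  finite over `K` (proper and quasi-finite, Zariski's main theorem);
* `AbelianVariety.isIsogeny_of_surjective_of_dim_eq` — **a surjective homomorphism between abelian
  varieties of the same dimension is an isogeny** (Görtz–Wedhorn II, Prop. 27.176 (iii) ⇒ (iv) with
  the tree's `IsIsogeny.of_isFinite_kerToSpec`; Milne 1986, Prop. 8.1), and
  `AbelianVariety.isIsogeny_of_surjective_end` — a surjective endomorphism is an isogeny. With
  `AbelianVariety.surjective_of_isSimple` (`Motives/AbelianVarietyImageSimpleProofs`) this gives:
  every non-zero endomorphism of a simple abelian variety is an isogeny (Mumford §19, Cor. 2 of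
  Thm. 1 for `X = Y`), the hypothesis `hiso` of the finite generation of `End(X)`.

## References

* U. Görtz, T. Wedhorn, *Algebraic Geometry I* (2nd ed. 2020), Prop. 5.38; *Algebraic Geometry
  II* (2023), Prop. 27.176, Cor. 27.63, (27.9.1). [GortzWedhorn2020] [GortzWedhorn2023]
* J. S. Milne, *Abelian Varieties*, in Cornell–Silverman (1986), §8, Prop. 8.1 (held:
  `book:cornellnd-arithmetic-geometry`). [Milne1986AbelianVarieties]
* D. Mumford, *Abelian Varieties* (1970), §19, Cor. 2 of Thm. 1. [MumfordAV1970]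

## Design

Theorems only (no definitions, no named facts). Dimensions are compared in `WithBot ℕ∞`
(`topologicalKrullDim`), heights in the specialisation order of Mathlib's `Scheme` preorder.
-/

open CategoryTheory CategoryTheory.Limits AlgebraicGeometry Order Topology TopologicalSpace
open Literature.AlgebraicGeometry.Resolution

universe u

noncomputable section

namespace Literature.AlgebraicGeometry.Motives


/-- For a sober `T₀` scheme-point preorder: `dim S = sup of heights`. [folklore] -/
theorem topologicalKrullDim_eq_iSup_height (S : Scheme.{u}) [Nonempty S] :
    topologicalKrullDim S = ((⨆ x : S, height x : ℕ∞) : WithBot ℕ∞) := by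
  rw [Literature.Topology.topologicalKrullDim_eq_krullDim (X := S)]
  exact krullDim_eq_iSup_height_of_nonempty

/-- Every point of a scheme specialises from a maximal point (the generic point of an irreducible
component containing it). [folklore] -/
theorem exists_isMax_ge {S : Scheme.{u}} (x : S) : ∃ g : S, IsMax g ∧ x ≤ g := by
  have hC := irreducibleComponent_mem_irreducibleComponents x
  have hirr : IsIrreducible (irreducibleComponent x) := isIrreducible_irreducibleComponent
  set g := hirr.genericPoint with hg
  have hgen : IsGenericPoint g (irreducibleComponent x) := by
    have h := hirr.isGenericPoint_genericPoint_closure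
    rwa [isClosed_irreducibleComponent.closure_eq] at h
  refine ⟨g, isMax_of_isGenericPoint_of_mem_irreducibleComponents hC hgen, ?_⟩
  rw [Scheme.le_iff_specializes]
  exact hgen.specializes mem_irreducibleComponent

/-- **The dimension of a scheme locally of finite type over a field is invariant under extension
of the base field**: for a cartesian square `X' = X ×_{k,σ} Spec L → X`,
`dim X' = dim X` (Görtz–Wedhorn I, Prop. 5.38). Maximal points of `X'` have the height of their
(maximal) images (`height_eq_height_apply_of_isMax`), `X' → X` is surjective, and every point
specialises from a maximal one. [cite: GortzWedhorn2020, Prop. 5.38] -/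
theorem topologicalKrullDim_eq_of_isPullback {k L : Type u} [Field k] [Field L] (σ : k →+* L)
    {X X' : Scheme.{u}} (p : X ⟶ Spec (.of k)) (π : X' ⟶ X) (p' : X' ⟶ Spec (.of L))
    (H : IsPullback π p' p (Spec.map (CommRingCat.ofHom σ))) [LocallyOfFiniteType p] :
    topologicalKrullDim X' = topologicalKrullDim X := by
  -- `π` is surjective
  have hff : (CommRingCat.ofHom σ).hom.FaithfullyFlat := by
    letI : Algebra k L := σ.toAlgebra
    rw [CommRingCat.hom_ofHom, show σ = algebraMap k L from rfl, RingHom.faithfullyFlat_algebraMap_iff]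
    infer_instance
  obtain ⟨-, hsurj⟩ := (flat_and_surjective_SpecMap_iff _).2 hff
  haveI : Surjective π := MorphismProperty.of_isPullback H.flip hsurj
  by_cases hX : Nonempty X
  swap
  · haveI : IsEmpty X := not_nonempty_iff.1 hX
    haveI : IsEmpty X' := ⟨fun z => IsEmpty.false (π z)⟩
    rw [Literature.Topology.topologicalKrullDim_eq_krullDim (X := X'),
      Literature.Topology.topologicalKrullDim_eq_krullDim (X := X), krullDim_eq_bot, krullDim_eq_bot]
  haveI := hX
  obtain ⟨x₀⟩ := hX
  obtain ⟨z₀, -⟩ := π.surjective x₀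
  haveI : Nonempty X' := ⟨z₀⟩
  rw [topologicalKrullDim_eq_iSup_height X', topologicalKrullDim_eq_iSup_height X]
  congr 1
  refine le_antisymm (iSup_le fun z => ?_) (iSup_le fun x => ?_)
  · obtain ⟨g, hgmax, hzg⟩ := exists_isMax_ge z
    calc height z ≤ height g := height_mono hzg
      _ = height (π g) := height_eq_height_apply_of_isMax σ p π p' H g hgmax
      _ ≤ ⨆ x : X, height x := le_iSup (fun x : X => height x) (π g)
  · obtain ⟨g, hgmax, hxg⟩ := exists_isMax_ge x
    obtain ⟨z, hz⟩ := π.surjective g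
    obtain ⟨g', hg'max, hzg'⟩ := exists_isMax_ge z
    have hle : g ≤ π g' := by
      rw [← hz, Scheme.le_iff_specializes]
      exact (Scheme.le_iff_specializes.1 hzg').map π.continuous
    calc height x ≤ height g := height_mono hxg
      _ ≤ height (π g') := height_mono hle
      _ = height g' := (height_eq_height_apply_of_isMax σ p π p' H g' hg'max).symm
      _ ≤ ⨆ z : X', height z := le_iSup (fun z : X' => height z) g'

/-- The dimension of a scheme is attained: it is the supremum of the heights of its points, read
in `WithBot ℕ∞`; for isomorphic schemes the dimensions agree. [folklore] -/
theorem topologicalKrullDim_eq_of_iso {S T : Scheme.{u}} (e : S ≅ T) :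
    topologicalKrullDim S = topologicalKrullDim T :=
  IsHomeomorph.topologicalKrullDim_eq _ (TopCat.homeoOfIso (Scheme.forgetToTop.mapIso e)).isHomeomorph

/-- **A scheme of dimension `≤ 0` with noetherian underlying space is finite**: every point is the
generic point of its irreducible component (a proper generisation would give a chain of length
`1`), generic points are unique, and there are finitely many components. [folklore] -/
theorem finite_of_topologicalKrullDim_le_zero (S : Scheme.{u}) [NoetherianSpace S]
    (h : topologicalKrullDim S ≤ 0) : Finite S := by
  classical
  by_cases hS : Nonempty S
  swap
  · haveI : IsEmpty S := not_nonempty_iff.1 hS; infer_instance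
  haveI := hS
  have hh : ∀ x : S, height x = 0 := fun x => by
    have h1 : ((⨆ y : S, height y : ℕ∞) : WithBot ℕ∞) ≤ 0 := by
      rw [← topologicalKrullDim_eq_iSup_height S]; exact h
    have h2 : (⨆ y : S, height y) ≤ 0 := by exact_mod_cast h1
    exact nonpos_iff_eq_zero.1 ((le_iSup (fun y : S => height y) x).trans h2)
  -- every point is the generic point of its irreducible component
  have key : ∀ x : S, IsGenericPoint x (irreducibleComponent x) := by
    intro x
    have hirr : IsIrreducible (irreducibleComponent x) := isIrreducible_irreducibleComponent
    have hgen : IsGenericPoint hirr.genericPoint (irreducibleComponent x) := by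
      have h := hirr.isGenericPoint_genericPoint_closure
      rwa [isClosed_irreducibleComponent.closure_eq] at h
    have hxg : x ≤ hirr.genericPoint :=
      Scheme.le_iff_specializes.2 (hgen.specializes mem_irreducibleComponent)
    have hx : x = hirr.genericPoint := by
      by_contra hne
      have hlt' : x < hirr.genericPoint := lt_of_le_not_ge hxg fun hgx =>
        hne ((Scheme.le_iff_specializes.1 hgx).antisymm (Scheme.le_iff_specializes.1 hxg)).eq
      have hlt : 0 < height hirr.genericPoint := by
        rw [← hh x]; exact height_strictMono hlt' (by rw [hh x]; exact ENat.coe_lt_top 0)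
      rw [hh] at hlt; exact lt_irrefl _ hlt
    rw [isGenericPoint_def]
    conv_lhs => rw [hx]
    exact hgen
  haveI : Finite (irreducibleComponents S) :=
    NoetherianSpace.finite_irreducibleComponents.to_subtype
  refine Finite.of_injective
    (fun x : S => (⟨irreducibleComponent x, irreducibleComponent_mem_irreducibleComponents x⟩ :
      irreducibleComponents S)) fun x y hxy => ?_
  have hxy' : irreducibleComponent x = irreducibleComponent y := congrArg Subtype.val hxy
  have hx := key x
  rw [hxy'] at hx
  exact hx.eq (key y)

namespace AbelianVariety

variable {K : Type u} [Field K] {A B : AbelianVariety K} (f : A ⟶ B)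

/-- **The kernel of a homomorphism has the dimension of the generic fibre.** For a surjective
homomorphism `f : A → B` with generic points `ξ` of `A`, the fibre `A_{f ξ}` and the kernel
`Ker f` become isomorphic after base change to `κ(ξ)` (the translation isomorphism
`A ×_B Spec κ(ξ) ≅ Spec κ(ξ) ×_K Ker f`, `transIso`), and dimension is invariant under extension
of the base field (`topologicalKrullDim_eq_of_isPullback`). [folklore] -/
theorem topologicalKrullDim_fiber_eq_ker :
    topologicalKrullDim ↥((Hom.toSchemeHom f).fiber ((Hom.toSchemeHom f) (genericPoint A.X.left))) =
      topologicalKrullDim ↥(Hom.ker f) := by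
  set φ := Hom.toSchemeHom f with hφ
  set ξ := genericPoint A.X.left with hξ
  set z₀ := A.X.left.fromSpecResidueField ξ with hz₀
  set b := B.X.left.fromSpecResidueField (φ ξ) with hb
  set r := φ.residueFieldMap ξ with hr
  -- work with `Spec.map (ofHom r.hom)` throughout (`ofHom r.hom = r` definitionally)
  set s : Spec ((Over.left A.X).residueField ξ) ⟶ Spec ((Over.left B.X).residueField (φ ξ)) :=
    Spec.map (CommRingCat.ofHom r.hom) with hs
  have hw : s ≫ b = z₀ ≫ φ := φ.SpecMap_residueFieldMap_fromSpecResidueField ξ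
  -- the generic fibre `F = A ×_B Spec κ(φ ξ)` and its base change `F''` to `κ(ξ)`
  set q : φ.fiber (φ ξ) ⟶ Spec (B.X.left.residueField (φ ξ)) := φ.fiberToSpecResidueField (φ ξ)
  haveI : LocallyOfFiniteType q := MorphismProperty.pullback_snd _ _ inferInstance
  have HF : IsPullback (pullback.fst q s) (pullback.snd q s) q s := IsPullback.of_hasPullback q s
  have h1 := topologicalKrullDim_eq_of_isPullback r.hom q (pullback.fst q s) (pullback.snd q s) HF
  -- `F'' ≅ A ×_B Spec κ(ξ) ≅ Spec κ(ξ) ×_K Ker f`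
  have e1 : pullback q s ≅ pullback φ (s ≫ b) := pullbackLeftPullbackSndIso φ b s
  have e2 : pullback φ (s ≫ b) ≅ pullback φ (z₀ ≫ φ) := by rw [hw]
  have e3 : pullback φ (z₀ ≫ φ) ≅ pullback (z₀ ≫ A.X.hom) (Hom.kerToSpec f) :=
    transIso f (z₀ ≫ φ) z₀ rfl
  have h2 := topologicalKrullDim_eq_of_iso ((e1.trans e2).trans e3)
  -- `Spec κ(ξ) ×_K Ker f` is a base change of `Ker f`
  set t := z₀ ≫ A.X.hom with ht
  set σ := (Spec.preimage t).hom with hσdef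
  have hσ : Spec.map (CommRingCat.ofHom σ) = t := Spec.map_preimage t
  set s₂ : Spec ((Over.left A.X).residueField ξ) ⟶ Spec (CommRingCat.of K) :=
    Spec.map (CommRingCat.ofHom σ) with hs₂
  have e4 : pullback t (Hom.kerToSpec f) ≅ pullback s₂ (Hom.kerToSpec f) :=
    pullback.congrHom hσ.symm rfl
  have HN : IsPullback (pullback.snd s₂ (Hom.kerToSpec f)) (pullback.fst s₂ (Hom.kerToSpec f))
      (Hom.kerToSpec f) s₂ := (IsPullback.of_hasPullback s₂ (Hom.kerToSpec f)).flip
  have h3 := topologicalKrullDim_eq_of_isPullback σ (Hom.kerToSpec f)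
    (pullback.snd s₂ (Hom.kerToSpec f)) (pullback.fst s₂ (Hom.kerToSpec f)) HN
  have h4 := topologicalKrullDim_eq_of_iso e4
  rw [← h1, h2, h4, h3]

/-- **Dimension formula for a surjective homomorphism: `dim A = dim B + dim Ker f`** (Görtz–Wedhorn
II, Prop. 27.176 / Cor. 27.63 type: the fibres of `f` are torsors under the kernel; Mumford §12).
Proof: for the generic point `ξ` of `A`, `dim A = height ξ = height (f ξ) + height_{A_{f ξ}} ξ`
(additivity of transcendence degrees, `height_eq_height_add_height_asFiber`), `f ξ` is the generic
point of `B`; every point `z` of the generic fibre gives `height (ι z) = dim B + height z ≤ dim A`,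
so `dim A = dim B + dim A_{f ξ}`, and `dim A_{f ξ} = dim Ker f`
(`topologicalKrullDim_fiber_eq_ker`). [cite: GortzWedhorn2023, Prop. 27.176] -/
theorem dim_eq_dim_add_topologicalKrullDim_ker [Surjective (Hom.toSchemeHom f)] :
    ((A.dim : ℕ∞) : WithBot ℕ∞) = B.dim + topologicalKrullDim ↥(Hom.ker f) := by
  set φ := Hom.toSchemeHom f with hφ
  haveI := irreducibleSpace_left A
  haveI := irreducibleSpace_left B
  set ξ := genericPoint A.X.left with hξ
  have hη : φ ξ = genericPoint B.X.left := RatFn.genericPoint_eq_of_isDominant φ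
  -- heights of generic points
  have hA : (height ξ : WithBot ℕ∞) = A.dim := by
    rw [Scheme.height_genericPoint, topologicalKrullDim_left]
  have hB : (height (φ ξ) : WithBot ℕ∞) = B.dim := by
    rw [hη, Scheme.height_genericPoint, topologicalKrullDim_left]
  -- additivity at `ξ`
  have hadd := Scheme.height_eq_height_add_height_asFiber φ B.X.hom ξ
  -- the generic fibre
  set F := φ.fiber (φ ξ) with hF
  haveI : Nonempty F := ⟨φ.asFiber ξ⟩
  have hdimF : topologicalKrullDim F = ((⨆ z : F, height z : ℕ∞) : WithBot ℕ∞) :=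
    topologicalKrullDim_eq_iSup_height F
  -- upper bound `height (asFiber ξ) ≤ dim F` and lower bound `dim B + height z ≤ dim A`
  have hup : height (φ.asFiber ξ) ≤ ⨆ z : F, height z := le_iSup (fun z : F => height z) _
  have hlow : ∀ z : F, height (φ ξ) + height z ≤ height ξ := fun z => by
    have h := Scheme.height_eq_height_add_height_asFiber φ B.X.hom (φ.fiberι (φ ξ) z)
    rw [height_asFiber_fiberι_eq φ (φ ξ) z] at h
    have hx : φ (φ.fiberι (φ ξ) z) = φ ξ := by
      have := φ.range_fiberι (φ ξ) ▸ Set.mem_range_self (f := φ.fiberι (φ ξ)) z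
      exact this
    rw [hx] at h
    rw [← h]
    exact height_mono (Scheme.le_iff_specializes.2 (genericPoint_specializes _))
  -- all heights are finite
  have hAfin : height ξ = (A.dim : ℕ∞) := by exact_mod_cast hA
  have hBfin : height (φ ξ) = (B.dim : ℕ∞) := by exact_mod_cast hB
  have hsup : (⨆ z : F, height z) = height (φ.asFiber ξ) := by
    refine le_antisymm (iSup_le fun z => ?_) hup
    have h1 := hlow z
    rw [hadd] at h1
    have hfin : height (φ ξ) ≠ ⊤ := by rw [hBfin]; exact ENat.coe_ne_top _
    exact (WithTop.add_le_add_iff_left hfin).1 h1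
  have hfib : topologicalKrullDim ↥(Hom.ker f) = (height (φ.asFiber ξ) : WithBot ℕ∞) := by
    rw [← topologicalKrullDim_fiber_eq_ker f]
    change topologicalKrullDim F = _
    rw [hdimF, hsup]
  rw [hfib, ← hB, ← WithBot.coe_add, ← hadd, hAfin]

/-- The kernel of a homomorphism of abelian varieties is a noetherian topological space (a closed
subscheme of the noetherian `A`). [folklore] -/
theorem noetherianSpace_ker : NoetherianSpace ↥(Hom.ker f) := by
  haveI := Literature.AlgebraicGeometry.Motives.AbelianVariety.isNoetherian_left A
  haveI : IsClosedImmersion (Hom.kerι f) := MorphismProperty.pullback_fst _ _ inferInstance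
  exact (Hom.kerι f).isClosedEmbedding.isInducing.noetherianSpace

/-- The kernel of a homomorphism of abelian varieties is proper over `K` (base change of the proper
`f`). [folklore] -/
theorem isProper_kerToSpec : IsProper (Hom.kerToSpec f) := by
  haveI := isProper_toSchemeHom f
  exact MorphismProperty.pullback_snd _ _ inferInstance

/-- **A zero-dimensional kernel is finite over `K`.** [folklore] -/
theorem isFinite_kerToSpec_of_topologicalKrullDim_le_zero
    (h : topologicalKrullDim ↥(Hom.ker f) ≤ 0) : IsFinite (Hom.kerToSpec f) := by
  haveI := noetherianSpace_ker f
  haveI := isProper_kerToSpec f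
  haveI : Finite ↥(Hom.ker f) := finite_of_topologicalKrullDim_le_zero _ h
  haveI : LocallyQuasiFinite (Hom.kerToSpec f) :=
    .of_finite_preimage_singleton _ fun _ => Set.toFinite _
  exact IsFinite.of_isProper_of_locallyQuasiFinite _

/-- **A surjective homomorphism between abelian varieties of the same dimension is an isogeny**
(Görtz–Wedhorn II, Prop. 27.176 (iii) ⇒ (iv) with the dimension formula: the kernel is
zero-dimensional, hence finite; Milne 1986, Prop. 8.1 (a)⇔(b)).
[cite: GortzWedhorn2023, Prop. 27.176] -/
theorem isIsogeny_of_surjective_of_dim_eq [Surjective (Hom.toSchemeHom f)] (h : A.dim = B.dim) :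
    IsIsogeny f := by
  have hd := dim_eq_dim_add_topologicalKrullDim_ker f
  rw [h] at hd
  have h0 : topologicalKrullDim ↥(Hom.ker f) ≤ 0 := by
    -- cancel `B.dim` in `B.dim = B.dim + d`
    rcases hdk : topologicalKrullDim ↥(Hom.ker f) with _ | d
    · exact bot_le
    · rw [hdk] at hd
      have hd' : ((B.dim : ℕ∞) : WithBot ℕ∞) = ((B.dim + d : ℕ∞) : WithBot ℕ∞) := by
        rw [hd]; rfl
      have hd'' : (B.dim : ℕ∞) = B.dim + d := by exact_mod_cast hd'
      have : d = 0 := by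
        have hfin : (B.dim : ℕ∞) ≠ ⊤ := ENat.coe_ne_top _
        have h3 : (B.dim : ℕ∞) + d ≤ B.dim + 0 := by rw [add_zero]; exact le_of_eq hd''.symm
        exact nonpos_iff_eq_zero.1 ((WithTop.add_le_add_iff_left hfin).1 h3)
      rw [this]; exact le_of_eq rfl
  haveI := isFinite_kerToSpec_of_topologicalKrullDim_le_zero f h0
  exact IsIsogeny.of_isFinite_kerToSpec f h

/-- **A surjective endomorphism of an abelian variety is an isogeny.** [folklore] -/
theorem isIsogeny_of_surjective_end (φ : A ⟶ A) [Surjective (Hom.toSchemeHom φ)] : IsIsogeny φ :=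
  isIsogeny_of_surjective_of_dim_eq φ rfl

end AbelianVariety

end Literature.AlgebraicGeometry.Motives
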